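import Summits.CriticalPhenomena.PercolationContinuityZ3.Theorems.PercNearOneGluingNoHeavyLowerTailSahiSunflowerHierarchy
import HarnessLib

/-!
# `NoHeavyLowerTail` (crux stmt-CriticalPhenomena-4575), master-family line P2: the percolation row `mPT-LB` in CLOSED FORM for every `m`, and the
# all-but-one-joined hierarchy as ONE polynomial inequality in the cell masses

Support file (seat `prim-masterthm-p2`, gen 4; `--supports stmt-CriticalPhenomena-4575`); no definition, no named fact, no sorry.  Memo SAHI-ROUTE.md §4.10(b), §4.13.
For a finite weighted graph and terminals `t : Fin m → V` (`m ≥ 3`) write `a = P(all terminals joined)`, `c_i = P(the terminals other than t i joined, not all)`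
(the cell masses of the pattern weight on `Sun m`).  Then (`sahiE_allBut_eq_rowJ`)
  `E_m(1_{(allBut t i)ᶜ} : i < m) = J_m(a; c)`   (`J` the row polynomial `Sun.rowJ`: `a(a+1)⋯(a+m−2)·b − Σ_{k≥2}(a+k−1)⋯(a+m−2)e_k(c)`, `b = 1 − a − Σc`),
generalising `sahiE4_fourPoint_eq` (gen 2, `m = 4`) to every `m`; and (`sahiPositive_pat_iff_rowJ`) the `m`-point all-but-one-joined algebra satisfies Sahi's
conjecture of EVERY order iff `J_m(a; c) ≥ 0`.
-/

namespace Summit.CriticalPhenomena.PercolationContinuityZ3.Theorems.SahiDeltaSystem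

open Finset Function MeasureTheory Literature.Combinatorics.Sahi2008
open Literature.Probability.Percolation
open Literature.Probability.Percolation.DecisionTree (ind ind_nonneg ind_of_mem ind_of_not_mem)
open Literature.Probability.LatticeModels (prodBernoulli)

namespace Sun

variable {m : ℕ} {V : Type*} [Fintype V]

/-- The core mass of the pattern weight is `P(all terminals joined)`. [this work] -/
theorem pushWeight_pat_core (w : Sym2 V → unitInterval) (t : Fin m → V) :
    pushWeight (bernoulliWeight w) (pat t) core = (prodBernoulli w).real (allJoined t) := by
  classical
  rw [pushWeight_eq_ex, ← ex_bernoulliWeight_ind]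
  congr 1
  funext ω
  by_cases h : ω ∈ allJoined t
  · rw [if_pos ((pat_eq_core_iff t ω).2 h), ind_of_mem h]
  · rw [if_neg (fun h' => h ((pat_eq_core_iff t ω).1 h')), ind_of_not_mem h]

/-- The petal masses of the pattern weight: `P(all but t i joined, not all joined)` (`m ≥ 3`). [this work] -/
theorem pushWeight_pat_pet (hm : 3 ≤ m) (w : Sym2 V → unitInterval) (t : Fin m → V) (i : Fin m) :
    pushWeight (bernoulliWeight w) (pat t) (pet i) = (prodBernoulli w).real (allBut t i \ allJoined t) := by
  classical
  rw [pushWeight_eq_ex, ← ex_bernoulliWeight_ind]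
  congr 1
  funext ω
  by_cases h : ω ∈ allBut t i \ allJoined t
  · rw [if_pos ((pat_eq_pet_iff hm t ω i).2 ⟨h.1, h.2⟩), ind_of_mem h]
  · rw [ind_of_not_mem h, if_neg]
    intro h'
    exact h ((pat_eq_pet_iff hm t ω i).1 h')

/-- **`mPT-LB` in closed form (every `m ≥ 3`)**: `E_m(1_{(allBut t i)ᶜ} : i) = J_m(P(all joined); P(all but t i joined, not all))`. [this work] -/
theorem sahiE_allBut_eq_rowJ (hm : 3 ≤ m + 1) (w : Sym2 V → unitInterval) (t : Fin (m + 1) → V) :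
    sahiE (bernoulliWeight w) (m + 1) (fun i => ind (allBut t i)ᶜ) =
      rowJ (m + 1) ((prodBernoulli w).real (allJoined t)) (fun i => (prodBernoulli w).real (allBut t i \ allJoined t)) := by
  rw [← row_pat_eq hm w t, row_eq_rowJ_core (sum_pushWeight_pat w t), pushWeight_pat_core]
  congr 1
  funext i
  exact pushWeight_pat_pet hm w t i

/-- **The `m`-point all-but-one-joined hierarchy as one polynomial inequality** (`m ≥ 3`): all orders ⟺ `J_m(a; c) ≥ 0` in the cell masses. [this work] -/
theorem sahiPositive_pat_iff_rowJ (hm : 3 ≤ m + 1) (w : Sym2 V → unitInterval) (t : Fin (m + 1) → V) :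
    (∀ n, SahiPositive (pushWeight (bernoulliWeight w) (pat t)) n) ↔
      0 ≤ rowJ (m + 1) ((prodBernoulli w).real (allJoined t)) (fun i => (prodBernoulli w).real (allBut t i \ allJoined t)) := by
  rw [sahiPositive_pat_iff_row hm w t, sahiE_allBut_eq_rowJ hm w t]

end Sun
end Summit.CriticalPhenomena.PercolationContinuityZ3.Theorems.SahiDeltaSystem
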